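import Literature.Geometry.Lorentzian.Stationary
import HarnessLib

/-!
# Crux `HawkingExtensionIsKerr` (stmt-FinalStateConjecture-17840), line `SketchIdeator2` —
# programme NH: null frames adapted to a spacelike plane (pointwise linear algebra)

Helper file of the line lead (c5), programme "NH" (near-horizon sign analysis of a degenerate
Killing horizon).  Pure linear algebra in one fibre `T_pM` of a pseudo-Riemannian metric `g` on a
`4`-manifold: given a linear map `A : ℝ² → T_pM` whose image `P = A(ℝ²)` is SPACELIKE
(`g(Av, Av) > 0` for `v ≠ 0`) and a non-zero NULL vector `K ⊥ P`, there are

* a `g`-orthonormal pair `A e₁, A e₂` spanning `P` (Gram–Schmidt in `(ℝ², A^*g)`),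
* a null vector `N ⊥ P` with `g(K, N) ≠ 0` (from any `Z` with `g(K, Z) ≠ 0`, nondegeneracy:
  project `Z` off `P`, then `N = Z' - (g(Z',Z')/2g(K,Z')) K`),

and `{A e₁, A e₂, K, N}` is a basis of `T_pM`, so that every `X ⊥ K, N` lies in `P`:
`g(X, X) = g(X, Ae₁)² + g(X, Ae₂)² ≥ 0`.  This is the null frame at a point of a spacelike section
of the horizon used by the NH assembly (O'Neill 1983, Ch. 5, pp. 141–143: spacelike subspaces and
their orthogonal complements; here signature-free, from nondegeneracy alone).
-/

noncomputable section

set_option linter.dupNamespace false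

namespace Summit.FinalStateConjecture.FinalStateConjecture.Theorems.HawkingExtensionIsKerr.SketchIdeator2

open Set Function Literature.Geometry.Lorentzian
open scoped Manifold ContDiff Topology

section LinearAlgebra

variable {V : Type*} [AddCommGroup V] [Module ℝ V] {W : Type*} [AddCommGroup W] [Module ℝ W]

/-- **Gram–Schmidt for a positive form on the image of a plane.**  If `B` is a symmetric bilinear
form on `V`, `A : W → V` linear with `B(Aw, Aw) > 0` for `w ≠ 0`, and `b₁, b₂ ∈ W` are linearly
independent, then there are `e₁, e₂ ∈ W` with `A e₁, A e₂` `B`-orthonormal such that `b₁, b₂` are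
combinations of `e₁, e₂`. -/
theorem exists_orthonormal_pair (B : V →ₗ[ℝ] V →ₗ[ℝ] ℝ) (hBs : ∀ v w, B v w = B w v)
    (A : W →ₗ[ℝ] V) (hpos : ∀ w : W, w ≠ 0 → 0 < B (A w) (A w)) {b₁ b₂ : W}
    (hind : LinearIndependent ℝ ![b₁, b₂]) :
    ∃ e₁ e₂ : W, B (A e₁) (A e₁) = 1 ∧ B (A e₂) (A e₂) = 1 ∧ B (A e₁) (A e₂) = 0 ∧
      (∃ r₁ r₂ s₁ s₂ : ℝ, b₁ = r₁ • e₁ + r₂ • e₂ ∧ b₂ = s₁ • e₁ + s₂ • e₂) := by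
  have hpair := LinearIndependent.pair_iff.1 hind
  have hb₁ : b₁ ≠ 0 := by
    intro h0
    have := hpair 1 0 (by rw [h0]; simp)
    exact one_ne_zero this.1
  have h1 : 0 < B (A b₁) (A b₁) := hpos b₁ hb₁
  set n₁ : ℝ := Real.sqrt (B (A b₁) (A b₁)) with hn₁
  have hn₁pos : 0 < n₁ := Real.sqrt_pos.2 h1
  have hn₁sq : n₁ ^ 2 = B (A b₁) (A b₁) := Real.sq_sqrt h1.le
  set e₁ : W := n₁⁻¹ • b₁ with he₁
  have he₁n : B (A e₁) (A e₁) = 1 := by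
    simp only [he₁, map_smul, LinearMap.smul_apply, smul_eq_mul]
    field_simp
    rw [hn₁sq]
  -- second vector: `u = b₂ - B(Ab₂, Ae₁) e₁`
  set u : W := b₂ - (B (A b₂) (A e₁)) • e₁ with hu
  have hu_expand : u = (-(B (A b₂) (A e₁) * n₁⁻¹)) • b₁ + (1 : ℝ) • b₂ := by
    rw [hu, he₁, smul_smul, one_smul, neg_smul, sub_eq_neg_add]
  have hu0 : u ≠ 0 := by
    intro h0
    have := hpair _ _ (by rw [← hu_expand]; exact h0)
    exact one_ne_zero this.2
  have hue₁ : B (A u) (A e₁) = 0 := by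
    simp only [hu, map_sub, map_smul, LinearMap.sub_apply, LinearMap.smul_apply, smul_eq_mul, he₁n,
      mul_one, sub_self]
  have h2 : 0 < B (A u) (A u) := hpos u hu0
  set n₂ : ℝ := Real.sqrt (B (A u) (A u)) with hn₂
  have hn₂pos : 0 < n₂ := Real.sqrt_pos.2 h2
  have hn₂sq : n₂ ^ 2 = B (A u) (A u) := Real.sq_sqrt h2.le
  set e₂ : W := n₂⁻¹ • u with he₂
  refine ⟨e₁, e₂, he₁n, ?_, ?_, ?_⟩
  · simp only [he₂, map_smul, LinearMap.smul_apply, smul_eq_mul]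
    field_simp
    rw [hn₂sq]
  · simp only [he₂, map_smul, smul_eq_mul]
    rw [hBs, hue₁, mul_zero]
  · refine ⟨n₁, 0, B (A b₂) (A e₁), n₂, ?_, ?_⟩
    · have h : n₁ • e₁ = b₁ := by rw [he₁, smul_smul, mul_inv_cancel₀ hn₁pos.ne', one_smul]
      rw [zero_smul, add_zero, h]
    · have h : n₂ • e₂ = u := by rw [he₂, smul_smul, mul_inv_cancel₀ hn₂pos.ne', one_smul]
      rw [h, hu]
      abel

/-- **A null vector complementary to a null `K ⊥ P`.**  If `B` is symmetric and nondegenerate,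
`f₁, f₂` are `B`-orthonormal, `K ≠ 0` is null with `B(K, f₁) = B(K, f₂) = 0`, then there is `N`
with `B(N, N) = 0`, `B(K, N) ≠ 0`, `B(N, f₁) = B(N, f₂) = 0`. -/
theorem exists_null_partner (B : V →ₗ[ℝ] V →ₗ[ℝ] ℝ) (hBs : ∀ v w, B v w = B w v)
    (hBnd : ∀ v, (∀ w, B v w = 0) → v = 0) {f₁ f₂ K : V}
    (h₁₁ : B f₁ f₁ = 1) (h₂₂ : B f₂ f₂ = 1) (h₁₂ : B f₁ f₂ = 0)
    (hK0 : K ≠ 0) (hKK : B K K = 0) (hK₁ : B K f₁ = 0) (hK₂ : B K f₂ = 0) :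
    ∃ N : V, B N N = 0 ∧ B K N ≠ 0 ∧ B N f₁ = 0 ∧ B N f₂ = 0 := by
  -- some `Z` pairs non-trivially with `K`
  obtain ⟨Z, hZ⟩ : ∃ Z, B K Z ≠ 0 := by
    by_contra h
    push Not at h
    exact hK0 (hBnd K h)
  -- project `Z` off the plane
  set Z' : V := Z - (B Z f₁) • f₁ - (B Z f₂) • f₂ with hZ'
  have h₂₁ : B f₂ f₁ = 0 := by rw [hBs]; exact h₁₂
  have hZ'₁ : B Z' f₁ = 0 := by
    simp only [hZ', map_sub, map_smul, LinearMap.sub_apply, LinearMap.smul_apply, smul_eq_mul, h₁₁,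
      mul_one, h₂₁, mul_zero, sub_self]
  have hZ'₂ : B Z' f₂ = 0 := by
    simp only [hZ', map_sub, map_smul, LinearMap.sub_apply, LinearMap.smul_apply, smul_eq_mul, h₁₂,
      mul_zero, sub_zero, h₂₂, mul_one, sub_self]
  have hKZ' : B K Z' = B K Z := by
    simp only [hZ', map_sub, map_smul, smul_eq_mul, hK₁, hK₂, mul_zero, sub_zero]
  have hKZ'0 : B K Z' ≠ 0 := by rw [hKZ']; exact hZ
  have hZ'K : B Z' K = B K Z' := hBs _ _
  -- the null partner `N = Z' - t K`, `t = B(Z',Z') / (2 B(K,Z'))`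
  set t : ℝ := B Z' Z' / (2 * B K Z') with ht
  set N : V := Z' - t • K with hN
  refine ⟨N, ?_, ?_, ?_, ?_⟩
  · simp only [hN, map_sub, map_smul, LinearMap.sub_apply, LinearMap.smul_apply, smul_eq_mul, hKK,
      mul_zero, sub_zero, hZ'K]
    rw [ht]
    field_simp
    ring
  · simp only [hN, map_sub, map_smul, smul_eq_mul, hKK, mul_zero, sub_zero]
    exact hKZ'0
  · simp only [hN, map_sub, map_smul, LinearMap.sub_apply, LinearMap.smul_apply, smul_eq_mul, hZ'₁,
      hK₁, mul_zero, sub_zero]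
  · simp only [hN, map_sub, map_smul, LinearMap.sub_apply, LinearMap.smul_apply, smul_eq_mul, hZ'₂,
      hK₂, mul_zero, sub_zero]

/-- **The null frame is a basis; vectors orthogonal to both null directions are spacelike.**  If
`B` is symmetric on a `4`-dimensional space, `f₁, f₂` are `B`-orthonormal, `K, N` satisfy
`B(K, N) ≠ 0`, `B(K,K) = B(N,N) = 0` and are `B`-orthogonal to `f₁, f₂`, then every `X` with
`B(X, K) = B(X, N) = 0` has `B(X, X) = B(X, f₁)² + B(X, f₂)²`. -/
theorem sq_norm_of_orthogonal_null_pair [FiniteDimensional ℝ V] (hdim : Module.finrank ℝ V = 4)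
    (B : V →ₗ[ℝ] V →ₗ[ℝ] ℝ) (hBs : ∀ v w, B v w = B w v) {f₁ f₂ K N : V}
    (h₁₁ : B f₁ f₁ = 1) (h₂₂ : B f₂ f₂ = 1) (h₁₂ : B f₁ f₂ = 0)
    (hKK : B K K = 0) (hNN : B N N = 0) (hKN : B K N ≠ 0)
    (hK₁ : B K f₁ = 0) (hK₂ : B K f₂ = 0) (hN₁ : B N f₁ = 0) (hN₂ : B N f₂ = 0)
    {X : V} (hXK : B X K = 0) (hXN : B X N = 0) :
    B X X = B X f₁ ^ 2 + B X f₂ ^ 2 := by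
  have h₂₁ : B f₂ f₁ = 0 := by rw [hBs]; exact h₁₂
  have hNK : B N K ≠ 0 := by rw [hBs]; exact hKN
  -- the frame
  set v : Fin 4 → V := ![f₁, f₂, K, N] with hv
  have hv0 : v 0 = f₁ := rfl
  have hv1 : v 1 = f₂ := rfl
  have hv2 : v 2 = K := rfl
  have hv3 : v 3 = N := rfl
  -- linear independence by pairing
  have hli : LinearIndependent ℝ v := by
    rw [Fintype.linearIndependent_iff]
    intro c hc i
    have hsum : ∑ i, c i • v i = c 0 • f₁ + c 1 • f₂ + c 2 • K + c 3 • N := by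
      rw [Fin.sum_univ_four, hv0, hv1, hv2, hv3]
    rw [hsum] at hc
    have p₁ := congrArg (fun w ↦ B w f₁) hc
    have p₂ := congrArg (fun w ↦ B w f₂) hc
    have pK := congrArg (fun w ↦ B w K) hc
    have pN := congrArg (fun w ↦ B w N) hc
    simp only [map_add, map_smul, LinearMap.add_apply, LinearMap.smul_apply, smul_eq_mul, map_zero,
      LinearMap.zero_apply, h₁₁, h₂₁, hK₁, hN₁, h₁₂, h₂₂, hK₂, hN₂, mul_one, mul_zero, add_zero,
      zero_add] at p₁ p₂ pK pN
    rw [hBs f₁ K, hK₁, hBs f₂ K, hK₂, hKK, hBs N K] at pK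
    rw [hBs f₁ N, hN₁, hBs f₂ N, hN₂, hNN] at pN
    simp only [mul_zero, zero_add, add_zero] at pK pN
    have hc3 : c 3 = 0 := (mul_eq_zero.1 pK).resolve_right hKN
    have hc2 : c 2 = 0 := (mul_eq_zero.1 pN).resolve_right hKN
    fin_cases i
    · exact p₁
    · exact p₂
    · exact hc2
    · exact hc3
  -- hence a basis: `X` is a combination
  have hcard : Fintype.card (Fin 4) = Module.finrank ℝ V := by rw [hdim]; simp
  have hspan : Submodule.span ℝ (Set.range v) = ⊤ := hli.span_eq_top_of_card_eq_finrank hcard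
  have hX : X ∈ Submodule.span ℝ (Set.range v) := by rw [hspan]; exact Submodule.mem_top
  obtain ⟨c, hc⟩ := (Submodule.mem_span_range_iff_exists_fun ℝ).1 hX
  have hXe : X = c 0 • f₁ + c 1 • f₂ + c 2 • K + c 3 • N := by
    rw [← hc, Fin.sum_univ_four, hv0, hv1, hv2, hv3]
  -- pair `X` with `K`, `N`, `f₁`, `f₂`
  have pK := hXK
  have pN := hXN
  rw [hXe] at pK pN
  simp only [map_add, map_smul, LinearMap.add_apply, LinearMap.smul_apply, smul_eq_mul] at pK pN
  rw [hBs f₁ K, hK₁, hBs f₂ K, hK₂, hKK, hBs N K] at pK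
  rw [hBs f₁ N, hN₁, hBs f₂ N, hN₂, hNN] at pN
  simp only [mul_zero, zero_add, add_zero] at pK pN
  have hc3 : c 3 = 0 := (mul_eq_zero.1 pK).resolve_right hKN
  have hc2 : c 2 = 0 := (mul_eq_zero.1 pN).resolve_right hKN
  have hX1 : B X f₁ = c 0 := by
    rw [hXe]
    simp only [map_add, map_smul, LinearMap.add_apply, LinearMap.smul_apply, smul_eq_mul, h₁₁, h₂₁,
      hK₁, hN₁, mul_one, mul_zero, add_zero]
  have hX2 : B X f₂ = c 1 := by
    rw [hXe]
    simp only [map_add, map_smul, LinearMap.add_apply, LinearMap.smul_apply, smul_eq_mul, h₁₂, h₂₂,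
      hK₂, hN₂, mul_one, mul_zero, add_zero, zero_add]
  rw [hX1, hX2]
  rw [hXe, hc2, hc3, zero_smul, zero_smul, add_zero, add_zero]
  simp only [map_add, map_smul, LinearMap.add_apply, LinearMap.smul_apply, smul_eq_mul, h₁₁, h₁₂,
    h₂₁, h₂₂]
  ring

end LinearAlgebra

section Metric

/-- **Null frame at a point of a spacelike immersed surface, adapted to a null normal `K`.**  For
a pseudo-Riemannian metric `g` on a `4`-manifold, a point `p`, a continuous linear
`A : ℝ² → T_pM` with spacelike image (`g(Aw, Aw) > 0`, `w ≠ 0`) and a non-zero null `K ⊥ A(ℝ²)`: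
there are `e₁, e₂ ∈ ℝ²` with `A e₁, A e₂` orthonormal and a null `N ⊥ A(ℝ²)` with `g(K, N) ≠ 0`,
and every `X ⊥ K, N` satisfies `g(X, X) = g(X, Ae₁)² + g(X, Ae₂)²` (in particular `≥ 0`). -/
theorem exists_nullFrame {M : Type*} [TopologicalSpace M] [ChartedSpace E4 M] [IsManifold (𝓡 4) ∞ M]
    (g : PseudoRiemannianMetric (𝓡 4) ∞ E4 (TangentSpace (𝓡 4) : M → Type _)) (p : M)
    (A : EuclideanSpace ℝ (Fin 2) →L[ℝ] TangentSpace (𝓡 4) p)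
    (hpos : ∀ w, w ≠ 0 → 0 < g.val p (A w) (A w)) {K : TangentSpace (𝓡 4) p}
    (hK0 : K ≠ 0) (hKK : g.val p K K = 0) (hKA : ∀ w, g.val p K (A w) = 0) :
    ∃ (e₁ e₂ : EuclideanSpace ℝ (Fin 2)) (N : TangentSpace (𝓡 4) p),
      g.val p (A e₁) (A e₁) = 1 ∧ g.val p (A e₂) (A e₂) = 1 ∧ g.val p (A e₁) (A e₂) = 0 ∧
      g.val p N N = 0 ∧ g.val p K N ≠ 0 ∧ (∀ w, g.val p N (A w) = 0) ∧
      ∀ X : TangentSpace (𝓡 4) p, g.val p X K = 0 → g.val p X N = 0 →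
        g.val p X X = g.val p X (A e₁) ^ 2 + g.val p X (A e₂) ^ 2 := by
  set B : TangentSpace (𝓡 4) p →ₗ[ℝ] TangentSpace (𝓡 4) p →ₗ[ℝ] ℝ := g.toBilinForm p with hB
  have hBapp : ∀ v w, B v w = g.val p v w := fun v w ↦ rfl
  have hBs : ∀ v w, B v w = B w v := fun v w ↦ g.symm p v w
  have hBnd : ∀ v, (∀ w, B v w = 0) → v = 0 := fun v hv ↦ g.nondegenerate p v hv
  -- the standard basis of `ℝ²`
  set b : Module.Basis (Fin 2) ℝ (EuclideanSpace ℝ (Fin 2)) :=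
    (EuclideanSpace.basisFun (Fin 2) ℝ).toBasis with hb
  have hind : LinearIndependent ℝ ![b 0, b 1] := by
    have h := b.linearIndependent
    have he : ![b 0, b 1] = ⇑b := by
      ext i : 1
      fin_cases i <;> rfl
    rw [he]
    exact h
  obtain ⟨e₁, e₂, h₁₁, h₂₂, h₁₂, r₁, r₂, s₁, s₂, hb₀, hb₁⟩ :=
    exists_orthonormal_pair B hBs (A : EuclideanSpace ℝ (Fin 2) →ₗ[ℝ] TangentSpace (𝓡 4) p)
      (fun w hw ↦ hpos w hw) hind
  simp only [ContinuousLinearMap.coe_coe] at h₁₁ h₂₂ h₁₂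
  have hK₁ : B K (A e₁) = 0 := hKA e₁
  have hK₂ : B K (A e₂) = 0 := hKA e₂
  obtain ⟨N, hNN, hKN, hN₁, hN₂⟩ := exists_null_partner B hBs hBnd h₁₁ h₂₂ h₁₂ hK0 hKK hK₁ hK₂
  haveI : FiniteDimensional ℝ (TangentSpace (𝓡 4) p) := inferInstanceAs (FiniteDimensional ℝ E4)
  have hdim : Module.finrank ℝ (TangentSpace (𝓡 4) p) = 4 := by
    change Module.finrank ℝ E4 = 4
    exact finrank_euclideanSpace_fin
  have hN₁' : g.val p N (A e₁) = 0 := hN₁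
  have hN₂' : g.val p N (A e₂) = 0 := hN₂
  refine ⟨e₁, e₂, N, h₁₁, h₂₂, h₁₂, hNN, hKN, fun w ↦ ?_, fun X hXK hXN ↦ ?_⟩
  · -- `w` is a combination of `b 0, b 1`, hence of `e₁, e₂`
    have hw : w = w 0 • b 0 + w 1 • b 1 := by
      have := (b.sum_repr w).symm
      rw [Fin.sum_univ_two] at this
      convert this using 2 <;> simp [hb]
    rw [hw, hb₀, hb₁]
    simp only [map_add, map_smul, smul_eq_mul]
    rw [hN₁', hN₂']
    ring
  · exact sq_norm_of_orthogonal_null_pair hdim B hBs h₁₁ h₂₂ h₁₂ hKK hNN hKN hK₁ hK₂ hN₁ hN₂ hXK hXN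

end Metric


/-- **Registered sub-goal form of the null frame (NH-F)** (closed statement over `E4`-charted
manifolds, crux stmt-FinalStateConjecture-17840). -/
theorem stub_nh_nullFrame : ∀ (M : Type) [TopologicalSpace M] [ChartedSpace E4 M] [IsManifold (𝓡 4) ∞ M] (g : PseudoRiemannianMetric (𝓡 4) ∞ E4 (TangentSpace (𝓡 4) : M → Type _)) (p : M) (A : EuclideanSpace ℝ (Fin 2) →L[ℝ] TangentSpace (𝓡 4) p) (K : TangentSpace (𝓡 4) p), (∀ w, w ≠ 0 → 0 < g.val p (A w) (A w)) → K ≠ 0 → g.val p K K = 0 → (∀ w, g.val p K (A w) = 0) → ∃ (e₁ e₂ : EuclideanSpace ℝ (Fin 2)) (N : TangentSpace (𝓡 4) p), g.val p (A e₁) (A e₁) = 1 ∧ g.val p (A e₂) (A e₂) = 1 ∧ g.val p (A e₁) (A e₂) = 0 ∧ g.val p N N = 0 ∧ g.val p K N ≠ 0 ∧ (∀ w, g.val p N (A w) = 0) ∧ ∀ X : TangentSpace (𝓡 4) p, g.val p X K = 0 → g.val p X N = 0 → g.val p X X = g.val p X (A e₁) ^ 2 + g.val p X (A e₂) ^ 2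 :=
  fun _ _ _ _ g p A _ hpos hK0 hKK hKA ↦ exists_nullFrame g p A hpos hK0 hKK hKA

end Summit.FinalStateConjecture.FinalStateConjecture.Theorems.HawkingExtensionIsKerr.SketchIdeator2

end
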